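import Summits.KontsevichZagierPeriods.Zeta5Search.LaiSweepShard

/-!
# `κ₃` sweep certificate — shard file 095 of 127 (shards 665–671 of 889)

HONEST FRAMING. Systematic search; no irrationality claim unless certified. This file only checks,
by `decide +kernel`, shards 665–671 of the order-cell sweep of the `κ₃` point `(74, 2180, 444; δ74)`
(engine `LaiSweepEngine`, soundness `LaiSweepJump/Free/Eval/Shard/Kappa3`; a shard is `⟨regime, n,
p, q, p', q', Lo, Up⟩`: `n` cells from `p/q` to `p'/q'` with integer rate sums in `[Lo, Up]`, `K =
128`, `D = 2^40`). It draws NO conclusion: only the capstone `LaiKappa3SweepCert`, which needs all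
127 shard files, does. Kernel cost of this file ≈ 560 cells × 0.3 s.
-/

namespace Summit.KontsevichZagierPeriods.Zeta5Search.Sweep

set_option maxHeartbeats 100000000 in
/-- Shard 665: 80 cells of regime B from `143/199` to `185/257`.
[cite: Lai2024BallRivoal, §4 Lemma 4.3] -/
theorem shard665 :
    Shard.check 128 (2^40)
      ⟨true, 80, 143, 199, 185, 257, 11794220318274, 17135798982177⟩ = true := by
  decide +kernel

set_option maxHeartbeats 100000000 in
/-- Shard 666: 80 cells of regime B from `185/257` to `181/251`.
[cite: Lai2024BallRivoal, §4 Lemma 4.3] -/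
theorem shard666 :
    Shard.check 128 (2^40)
      ⟨true, 80, 185, 257, 181, 251, 11969979532758, 17409568306076⟩ = true := by
  decide +kernel

set_option maxHeartbeats 100000000 in
/-- Shard 667: 80 cells of regime B from `181/251` to `190/263`.
[cite: Lai2024BallRivoal, §4 Lemma 4.3] -/
theorem shard667 :
    Shard.check 128 (2^40)
      ⟨true, 80, 181, 251, 190, 263, 12395265128730, 18047690358860⟩ = true := by
  decide +kernel

set_option maxHeartbeats 100000000 in
/-- Shard 668: 80 cells of regime B from `190/263` to `309/427`.
[cite: Lai2024BallRivoal, §4 Lemma 4.3] -/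
theorem shard668 :
    Shard.check 128 (2^40)
      ⟨true, 80, 190, 263, 309, 427, 11457119643523, 16699310192656⟩ = true := by
  decide +kernel

set_option maxHeartbeats 100000000 in
/-- Shard 669: 80 cells of regime B from `309/427` to `166/229`.
[cite: Lai2024BallRivoal, §4 Lemma 4.3] -/
theorem shard669 :
    Shard.check 128 (2^40)
      ⟨true, 80, 309, 427, 166, 229, 11617045546776, 16949851391478⟩ = true := by
  decide +kernel

set_option maxHeartbeats 100000000 in
/-- Shard 670: 80 cells of regime B from `166/229` to `236/325`.
[cite: Lai2024BallRivoal, §4 Lemma 4.3] -/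
theorem shard670 :
    Shard.check 128 (2^40)
      ⟨true, 80, 166, 229, 236, 325, 11843457080900, 17298267827965⟩ = true := by
  decide +kernel

set_option maxHeartbeats 100000000 in
/-- Shard 671: 80 cells of regime B from `236/325` to `267/367`.
[cite: Lai2024BallRivoal, §4 Lemma 4.3] -/
theorem shard671 :
    Shard.check 128 (2^40)
      ⟨true, 80, 236, 325, 267, 367, 12796264145956, 18710870461607⟩ = true := by
  decide +kernel

/-- The checked shards of this file, in order. [folklore] -/
def shards095 : List (CheckedShard 128 (2^40)) :=
  [⟨_, shard665⟩, ⟨_, shard666⟩, ⟨_, shard667⟩, ⟨_, shard668⟩, ⟨_, shard669⟩,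
    ⟨_, shard670⟩, ⟨_, shard671⟩]

end Summit.KontsevichZagierPeriods.Zeta5Search.Sweep
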